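import Mathlib
import HarnessLib
import Literature.Analysis.FluidPDE.KNSSTypeIRateLiouvilleMild
import Literature.Analysis.FluidPDE.NSBoundedMildOseenClassical
import Literature.Analysis.FluidPDE.ClassicalSolutionGlue
import Literature.Analysis.FluidPDE.VorticityEquation
import Summits.NavierStokesRegularity.NavierStokesRegularity.Theorems.UnthreadedRigidityDoorWindowAnalyticLocal

/-!
# Route UnthreadedRigidityDoor · crux `UnthreadedRigidity` (stmt-NavierStokesRegularity-27585) · LINE «jet rigidity»
# (planner ns-idea-6 g5, birth skeleton sha16 `5d320f85a8de9ffc`) — stub `stub_windowAnalytic`, file 2/2: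
# the VORTICITY FORMULATION on an open time window, and the stub VERBATIM

Seat ns-qj-p1 g3 (director-ns KEY-NS #141), `--supports stmt-NavierStokesRegularity-27585 --as helper`.
This file proves the registered stub `StubWindowAnalytic` VERBATIM (binders restated — a Theorems file cannot
import the planner's HOME skeleton): a continuous, divergence-free, Oseen-mild field `u` on an open preconnected
time window `S`, bounded on every initial segment of `S`, is jointly real-analytic on `S × ℝ³` (file 1/2,
`analyticOnNhd_uncurry_of_oseenMild_of_isOpen`) AND a classical solution of the vorticity formulation
`IsVorticitySolutionOn S 1 u`.

PROOF of the vorticity formulation (all inputs are theorems of the tree).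
1. `isMildNSSolutionBetween_of_oseenMild` — the Oseen identity between two times `s < t` of `S`, a bound on
   `[s, t]`, and continuity give the two-time DUALITY identity (Lemarié-Rieusset 2016, Thm. 6.1 (6.12) ⇒ (6.11):
   pair with a solenoidal test, `integral_inner_heatExtension_comm_of_bound`,
   `integral_inner_oseenDuhamel_eq_neg_intervalIntegral` — the window form of the tree's
   `isBoundedAncientMildSolution_of_oseen`).
2. `exists_isClassicalNSSolutionOn_Ioo` — around each `t₁ ∈ S` pick `[s, T₂] ⊆ S`; the translate
   `w = u(· + s)` is a duality-form mild solution on `(0, T₂ − s)` from the bounded datum `u(s)` (weakly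
   divergence-free slices from `div u = 0` and `C¹`, `IsDivFree.isWeaklyDivFree_holds`), jointly smooth (file
   1/2) and bounded, so Fabes–Jones–Rivière 1972 Thm. 2.1 (`classical_of_smooth_isMildNSSolutionOn_holds`) gives
   a smooth pressure; translate back.
3. `windowAnalytic` — curl of the momentum equation on each such window (Majda–Bertozzi Prop. 2.21,
   `isVorticitySolutionOn_of_isOpen`); the windows glue because one-sided time derivatives within two open
   sets containing `t₁` coincide (`derivWithin_of_isOpen`); `div u(t) = 0` is the hypothesis itself.

HONEST FRAMING: a regularity/bookkeeping statement about HYPOTHETICAL bounded window solutions (local blow-up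
profiles of the door); it is the BRIDGE stub of a line whose wall (`stub_shearedRigidity`) is OPEN; nothing
here bears on `UnthreadedRigidity`, the door Target, or Navier–Stokes regularity; no summit statement is proved.
[folklore]

References: P. G. Lemarié-Rieusset (2016) Thm. 6.1, Thm. 9.12; E. B. Fabes, B. F. Jones, N. M. Rivière, ARMA 45
(1972) Thm. 2.1; A. J. Majda, A. L. Bertozzi (CUP 2002) Prop. 2.21; KNSS, Acta Math. 203 (2009) §4.
-/

noncomputable section

-- the summit and its single sub-problem share the name (CONVENTIONS §1), as in every Theorems file
set_option linter.dupNamespace false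

namespace Summit.NavierStokesRegularity.NavierStokesRegularity.Theorems.UnthreadedRigidity

open Literature.Analysis.FluidPDE MeasureTheory Set Function Filter Topology
open Literature.Analysis.UnboundedOperators (heatExtension)
open scoped ENNReal NNReal RealInnerProductSpace ContDiff

variable {S : Set ℝ} {u : ℝ → (EuclideanSpace ℝ (Fin 3)) → (EuclideanSpace ℝ (Fin 3))}

/-! ### 1. Oseen identity ⇒ two-time duality identity -/

/-- **The Oseen identity between two times gives the duality identity** (Lemarié-Rieusset 2016, Thm. 6.1,
(6.12) ⇒ (6.11); window form of the tree's `isBoundedAncientMildSolution_of_oseen`): for `s < t` in `S`,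
`[s, t] ⊆ S`, `u` continuous on `S × ℝ³` and bounded by `K` on `[s, t]`, the pointwise identity
`u(t) = e^{(t−s)Δ}u(s) − B¹_s(u,u)(t)` implies `IsMildNSSolutionBetween 1 0 u s t`.
[cite: LemarieRieusset2016, Thm. 6.1 ((6.12) ⇒ (6.11))] -/
theorem isMildNSSolutionBetween_of_oseenMild (hcont : ContinuousOn (uncurry u) (S ×ˢ univ)) {s t : ℝ}
    (hst : s < t) (hsub : Icc s t ⊆ S) {K : ℝ} (hK : ∀ τ ∈ Icc s t, ∀ x, ‖u τ x‖ ≤ K)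
    (hmild : ∀ x, u t x = heatExtension (u s) (t - s) x - oseenDuhamel 1 s u u t x) :
    IsMildNSSolutionBetween 1 0 u s t := by
  intro φ hφ hφdiv
  have hts : 0 < t - s := sub_pos.2 hst
  have hsS : s ∈ S := hsub (left_mem_Icc.2 hst.le)
  have hK0 : 0 ≤ K := (norm_nonneg _).trans (hK s (left_mem_Icc.2 hst.le) 0)
  have hWc : Continuous (u s) := continuous_slice_of_continuousOn hcont hsS
  have hKs : ∀ z, ‖u s z‖ ≤ K := fun z => hK s (left_mem_Icc.2 hst.le) z
  -- measurability of `u` on the window `(s, t) × E`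
  have hmeas : AEStronglyMeasurable (uncurry u)
      ((volume : Measure (ℝ × (EuclideanSpace ℝ (Fin 3)))).restrict (Ioo s t ×ˢ univ)) := by
    refine (hcont.mono ?_).aestronglyMeasurable (measurableSet_Ioo.prod MeasurableSet.univ)
    exact prod_mono (fun τ hτ => hsub (Ioo_subset_Icc_self hτ)) subset_rfl
  have hφc : Continuous φ := hφ.contDiff.continuous
  have hφi : Integrable φ := hφc.integrable_of_hasCompactSupport hφ.hasCompactSupport
  have hKτ : ∀ τ ∈ Ioo s t, ∀ y, ‖u τ y‖ ≤ K := fun τ hτ y => hK τ (Ioo_subset_Icc_self hτ) y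
  -- the two pairings of the representation formula
  have h1 : Integrable (fun x => ⟪heatExtension (u s) (1 * (t - s)) x, φ x⟫) :=
    integrable_inner_of_aestronglyMeasurable_of_norm_le
      ((Literature.Analysis.UnboundedOperators.contDiff_heatExtension_of_bound (m := 0) hWc
        hKs (mul_pos one_pos hts)).continuous.aestronglyMeasurable)
      (fun x => Literature.Analysis.UnboundedOperators.norm_heatExtension_le_of_bound hKs
        (mul_pos one_pos hts) x) hφi
  have h2 : Integrable (fun x => ⟪oseenDuhamel 1 s u u t x, φ x⟫) := by
    obtain ⟨C, hC, hB⟩ := exists_norm_oseenDuhamel_bounded_le (E := EuclideanSpace ℝ (Fin 3))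
    exact integrable_inner_of_aestronglyMeasurable_of_norm_le
      (aestronglyMeasurable_oseenDuhamel one_pos hmeas hmeas hK0 hKτ hKτ hst le_rfl)
      (fun x => hB one_pos hst hK0 hKτ hKτ x) hφi
  -- assemble
  have hlhs : (fun x => ⟪u t x, φ x⟫) = fun x =>
      ⟪heatExtension (u s) (1 * (t - s)) x, φ x⟫ - ⟪oseenDuhamel 1 s u u t x, φ x⟫ := by
    funext x
    rw [hmild x, one_mul, inner_sub_left]
  rw [hlhs, integral_sub h1 h2,
    integral_inner_heatExtension_comm_of_bound hWc.aestronglyMeasurable hKs hφc hφ.hasCompactSupport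
      (mul_pos one_pos hts),
    integral_inner_oseenDuhamel_eq_neg_intervalIntegral one_pos hmeas hK0 hKτ hst le_rfl hφ hφdiv,
    heatTest_of_pos one_pos hts]
  simp

/-! ### 2. Classical on small windows -/

/-- **Around every time of the window the field is a classical Navier–Stokes solution for some smooth
pressure**: on `[s, T₂] ⊆ S` with `s < t₁ < T₂`, the translate `u(· + s)` is a duality-form mild solution on
`(0, T₂ − s)` from the bounded datum `u(s)`, jointly smooth and bounded, hence classical by
Fabes–Jones–Rivière 1972 Thm. 2.1 (`classical_of_smooth_isMildNSSolutionOn_holds`); translate back.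
[cite: FabesJonesRiviere1972, Thm. 2.1] -/
theorem exists_isClassicalNSSolutionOn_Ioo (hS : IsOpen S)
    (hcont : ContinuousOn (uncurry u) (S ×ˢ univ))
    (hdiv : ∀ t ∈ S, VectorCalculus.IsDivFree (u t))
    (hmild : ∀ s ∈ S, ∀ t ∈ S, s < t → ∀ x,
      u t x = heatExtension (u s) (t - s) x - oseenDuhamel 1 s u u t x)
    (hbdd : ∀ τ ∈ S, ∃ B : ℝ, ∀ t ∈ S, t ≤ τ → ∀ x, ‖u t x‖ ≤ B) {t₁ : ℝ} (ht₁ : t₁ ∈ S) :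
    ∃ s T₂ : ℝ, s < t₁ ∧ t₁ < T₂ ∧ Ioo s T₂ ⊆ S ∧
      ∃ p : ℝ → EuclideanSpace ℝ (Fin 3) → ℝ, IsClassicalNSSolutionOn (Ioo s T₂) 1 0 u p := by
  have hsm : IsSmoothSpaceTimeOn S u := isSmoothSpaceTimeOn_of_oseenMild_of_isOpen hS hcont hmild hbdd
  -- the window `[s, T₂] = [t₁ - ρ, t₁ + ρ] ⊆ S`
  obtain ⟨ρ₀, hρ₀, hball⟩ := Metric.isOpen_iff.1 hS t₁ ht₁
  set ρ : ℝ := ρ₀ / 2 with hρ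
  have hρ0 : 0 < ρ := by positivity
  have hmemS : ∀ t : ℝ, t₁ - ρ ≤ t → t ≤ t₁ + ρ → t ∈ S := fun t h1 h2 =>
    hball (by rw [Metric.mem_ball, Real.dist_eq, abs_lt]; constructor <;> linarith)
  set s : ℝ := t₁ - ρ with hs_def
  set T₂ : ℝ := t₁ + ρ with hT₂_def
  have hsS : s ∈ S := hmemS s le_rfl (by linarith)
  have hT : 0 < T₂ - s := by simp only [hs_def, hT₂_def]; linarith
  have hIcc : Icc s T₂ ⊆ S := fun t ht => hmemS t ht.1 ht.2
  -- a bound `K ≥ 0` on `[s, T₂]`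
  obtain ⟨B, hB⟩ := hbdd T₂ (hmemS T₂ (by linarith) le_rfl)
  set K : ℝ := max B 0 with hK_def
  have hK : ∀ t ∈ Icc s T₂, ∀ x, ‖u t x‖ ≤ K := fun t ht x =>
    (hB t (hIcc ht) ht.2 x).trans (le_max_left _ _)
  refine ⟨s, T₂, by linarith, by linarith, fun t ht => hIcc (Ioo_subset_Icc_self ht), ?_⟩
  -- the translate `w = u(· + s)` is a duality-form mild solution on `(0, T₂ - s)` from `u s`
  set w : ℝ → EuclideanSpace ℝ (Fin 3) → EuclideanSpace ℝ (Fin 3) := fun t => u (t + s) with hw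
  have hmildw : IsMildNSSolutionOn (Ioo 0 (T₂ - s)) 1 0 (u s) w := by
    refine ⟨fun t ht => ?_, fun t ht => ?_⟩
    · have hts : t + s ∈ S := hIcc ⟨by linarith [ht.1], by linarith [ht.2]⟩
      have hC1 : ContDiff ℝ 1 (u (t + s)) := (hsm.contDiff_slice hts).of_le (by norm_cast)
      exact VectorCalculus.IsDivFree.isWeaklyDivFree_holds (hdiv (t + s) hts) hC1
    · have hpair : IsMildNSSolutionBetween 1 0 u (0 + s) (t + s) := by
        rw [zero_add]
        have htsS : t + s ∈ S := hIcc ⟨by linarith [ht.1], by linarith [ht.2]⟩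
        refine isMildNSSolutionBetween_of_oseenMild hcont (by linarith [ht.1])
          (fun τ hτ => hIcc ⟨hτ.1, by linarith [hτ.2, ht.2]⟩)
          (fun τ hτ x => hK τ ⟨hτ.1, by linarith [hτ.2, ht.2]⟩ x) fun x => ?_
        have h := hmild s hsS (t + s) htsS (by linarith [ht.1]) x
        rwa [add_sub_cancel_right] at h ⊢
      have key : IsMildNSSolutionBetween 1 0 w 0 t := hpair.comp_add_right_zero
      simpa [hw] using (isMildNSSolutionFrom_self_iff (u := w)).2 key
  -- joint smoothness of the translate
  have hsmw : IsSmoothSpaceTimeOn (Ioo 0 (T₂ - s)) w := by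
    refine (hsm.comp_add_right s).mono fun t ht => ?_
    exact hIcc ⟨by linarith [ht.1], by linarith [ht.2]⟩
  -- uniform bound on the translated window
  have hbddw : ∀ T₁ ∈ Ioo 0 (T₂ - s), ∃ K' : ℝ≥0∞, K' < ⊤ ∧ ∀ t ∈ Ioo 0 T₁, eLpNorm (w t) ∞ volume ≤ K' := by
    intro T₁ hT₁
    refine ⟨ENNReal.ofReal K, ENNReal.ofReal_lt_top, fun t ht => ?_⟩
    rw [eLpNorm_exponent_top]
    refine eLpNormEssSup_le_of_ae_bound (Eventually.of_forall fun x => ?_)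
    exact hK (t + s) ⟨by linarith [ht.1], by linarith [ht.2, hT₁.2]⟩ x
  -- the datum: measurable and integrable against Gaussians (bounded by `K`)
  have hu₀m : AEStronglyMeasurable (u s) volume := (continuous_slice_of_continuousOn hcont hsS).aestronglyMeasurable
  have hKs : ∀ y, ‖u s y‖ ≤ K := fun y => hK s (left_mem_Icc.2 (by linarith)) y
  have hu₀G : ∀ a : ℝ, 0 < a →
      Integrable (fun y => Literature.Analysis.UnboundedOperators.heatKernel a y * ‖u s y‖) volume := by
    intro a ha
    have hKi : Integrable (Literature.Analysis.UnboundedOperators.heatKernel (E := EuclideanSpace ℝ (Fin 3)) a)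
        volume := Literature.Analysis.UnboundedOperators.integrable_heatKernel_holds ha
    have h := hKi.bdd_mul (c := K) hu₀m.norm (Eventually.of_forall fun y => by rw [norm_norm]; exact hKs y)
    refine h.congr (Eventually.of_forall fun y => ?_)
    simp only [mul_comm]
  obtain ⟨q, hcl⟩ := classical_of_smooth_isMildNSSolutionOn_holds (EuclideanSpace ℝ (Fin 3)) one_pos hT
    hu₀m hu₀G hsmw hbddw hmildw
  -- translate back to `(s, T₂)`
  refine ⟨fun t => q (t - s), ?_⟩
  have h1 := hcl.comp_add_right (-s)
  have hset : (fun t : ℝ => t + -s) ⁻¹' Ioo 0 (T₂ - s) = Ioo s T₂ := by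
    ext t
    simp only [mem_preimage, mem_Ioo]
    constructor
    · rintro ⟨h1, h2⟩; exact ⟨by linarith, by linarith⟩
    · rintro ⟨h1, h2⟩; exact ⟨by linarith, by linarith⟩
  rw [hset] at h1
  have hf : (fun t : ℝ => (0 : ℝ → EuclideanSpace ℝ (Fin 3) → EuclideanSpace ℝ (Fin 3)) (t + -s)) = 0 := by
    funext t; rfl
  have hu' : (fun t : ℝ => w (t + -s)) = u := by
    funext t; simp only [hw]; congr 1; ring
  have hp' : (fun t : ℝ => q (t + -s)) = fun t => q (t - s) := by
    funext t; rw [← sub_eq_add_neg]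
  rw [hf, hu', hp'] at h1
  exact h1

/-! ### 3. The registered stub, verbatim -/

/-- **Stub `stub_windowAnalytic` of the registered birth skeleton of crux `UnthreadedRigidity`
(stmt-NavierStokesRegularity-27585; LINE «jet rigidity», planner ns-idea-6 g5, sha16 `5d320f85a8de9ffc`), signature
VERBATIM (`StubWindowAnalytic`).** A continuous, divergence-free, Oseen-mild field on an open preconnected time
window `S`, bounded on every initial segment of `S`, is jointly real-analytic on `S × ℝ³` (Lemarié-Rieusset 2016
Thm. 9.12, file 1/2) and a classical solution of the vorticity formulation on `S` (Oseen ⇒ duality-mild ⇒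
classical with a pressure on small windows by Fabes–Jones–Rivière ⇒ curl of the momentum equation, windows
glued by `derivWithin_of_isOpen`). The preconnectedness of `S` is not used. The BRIDGE of the line; nothing here
bears on `UnthreadedRigidity` or Navier–Stokes regularity.
[cite: LemarieRieusset2016, Thm. 9.12; KochNadirashviliSereginSverak2009, §4 (arXiv p. 8)] -/
theorem windowAnalytic :
    ∀ (S : Set ℝ) (u : ℝ → EuclideanSpace ℝ (Fin 3) → EuclideanSpace ℝ (Fin 3)), IsOpen S → IsPreconnected S →
    ContinuousOn (Function.uncurry u) (S ×ˢ Set.univ) →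
    (∀ t ∈ S, Literature.Analysis.FluidPDE.VectorCalculus.IsDivFree (u t)) →
    (∀ s ∈ S, ∀ t ∈ S, s < t → ∀ x, u t x = Literature.Analysis.UnboundedOperators.heatExtension (u s) (t - s) x
        - Literature.Analysis.FluidPDE.oseenDuhamel 1 s u u t x) →
    (∀ τ ∈ S, ∃ B : ℝ, ∀ t ∈ S, t ≤ τ → ∀ x, ‖u t x‖ ≤ B) →
    AnalyticOnNhd ℝ (Function.uncurry u) (S ×ˢ Set.univ) ∧ Literature.Analysis.FluidPDE.IsVorticitySolutionOn S 1 u := by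
  intro S u hS _ hcont hdiv hmild hbdd
  have han := analyticOnNhd_uncurry_of_oseenMild_of_isOpen hS hcont hmild hbdd
  have hsm : IsSmoothSpaceTimeOn S u := isSmoothSpaceTimeOn_of_oseenMild_of_isOpen hS hcont hmild hbdd
  refine ⟨han, ⟨hsm, fun t ht x => ?_, hdiv⟩⟩
  obtain ⟨s, T₂, hst, htT, hsub, p, hcl⟩ := exists_isClassicalNSSolutionOn_Ioo hS hcont hdiv hmild hbdd ht
  have hV : IsVorticitySolutionOn (Ioo s T₂) 1 u :=
    hcl.isVorticitySolutionOn_of_isOpen isOpen_Ioo fun _ _ y => curl_zero y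
  have ht' : t ∈ Ioo s T₂ := ⟨hst, htT⟩
  have key := hV.vorticity_eq t ht' x
  have h1 : timeDerivWithin S (vorticity u) t x = timeDerivWithin (Ioo s T₂) (vorticity u) t x := by
    rw [timeDerivWithin_apply, timeDerivWithin_apply, derivWithin_of_isOpen hS ht,
      derivWithin_of_isOpen isOpen_Ioo ht']
  rw [h1]
  exact key

/-- Alias under the skeleton's stub name. [folklore] -/
theorem stub_windowAnalytic :
    ∀ (S : Set ℝ) (u : ℝ → EuclideanSpace ℝ (Fin 3) → EuclideanSpace ℝ (Fin 3)), IsOpen S → IsPreconnected S →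
    ContinuousOn (Function.uncurry u) (S ×ˢ Set.univ) →
    (∀ t ∈ S, Literature.Analysis.FluidPDE.VectorCalculus.IsDivFree (u t)) →
    (∀ s ∈ S, ∀ t ∈ S, s < t → ∀ x, u t x = Literature.Analysis.UnboundedOperators.heatExtension (u s) (t - s) x
        - Literature.Analysis.FluidPDE.oseenDuhamel 1 s u u t x) →
    (∀ τ ∈ S, ∃ B : ℝ, ∀ t ∈ S, t ≤ τ → ∀ x, ‖u t x‖ ≤ B) →
    AnalyticOnNhd ℝ (Function.uncurry u) (S ×ˢ Set.univ) ∧ Literature.Analysis.FluidPDE.IsVorticitySolutionOn S 1 u :=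
  windowAnalytic

end Summit.NavierStokesRegularity.NavierStokesRegularity.Theorems.UnthreadedRigidity

end
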